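import Summits.QuantumFields.YangMills.Theorems.BalabanUVNodesPortHRecordRowGBase
import Summits.QuantumFields.YangMills.Theorems.BalabanUVNodesPortS1LZdetGeom
import Literature.MathematicalPhysics.QuantumFieldTheory.Balaban1983to89.TreeLengthTorusTransfer
import Literature.MathematicalPhysics.QuantumFieldTheory.Balaban1983to89.B3Taylor310LocalRemainder

/-!
# NODE O port PT-A — `stub_G3C` (repaired edition), layer (D3-geo): TWO CUBES OFF EACH OTHER'S `3^d` BLOCK ARE ONE FULL CUBE APART IN LATTICE UNITS — if the cube of the level-`k` site `x`
# is not in `tblock` of the cube of `y`, then `L·Mc ≤ Site.tdist x y` (level-`k` units) — the geometric letter that turns the lattice Combes–Thomas decay of the local inverses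
# (✓`norm_g3cLocInv_apply_le_exp`) into the per-step factor `e^{−κ·L·Mc}` of the `d_j = 0` sticking-out pieces (memo §5b (ii))

Cell `ym-nodeO-ideate`, porter hand `hand-27930-G3C` (g0); proof kind, `--supports stmt-QuantumFields-27930 --as helper`; count-neutral.  [I] = [Balaban1987RG1], [B9] = [Balaban1985BackgroundPropagators].

WHAT THIS FILE PROVES (sorry-free): `G3CGeom.le_natAbs_valMinAbs_of_two_le` (ZMod: if the `M`-cube classes of two residues mod `q·M` are at circular distance `≥ 2`, the residues are at circular
distance `≥ M` — the converse companion of ✓`PortHRecordRowG.dist_le_mul_idx_add`), `G3CGeom.exists_two_le_of_not_mem_tblock` (`c ∉ tblock q ⟹` some coordinate classes differ by `≥ 2`),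
`sitesPerDir_k_eq_domCount_mul` (tiling at level `k`: `N_k = domCount·(L·Mc)`), `cubeOfSite_blockOf_apply_val` (the cube label of a level-`k` site is `⌊x_μ∕(L·Mc)⌋`),
★ `mul_le_tdist_of_cube_not_mem_tblock` (`L·Mc ≤ tdist x y`).

HONEST FRAMING.  Torus bookkeeping; nothing of Bałaban's asserted, ported or discharged; `stub_G3C` NOT closed; 27930 OPEN; NODE O 0∕1; COUNT 8∕28 · K 1∕4 UNMOVED; finite `𝕋⁴` at fixed ε — NOT
continuum ∕ OS ∕ Clay; **the Yang–Mills mass gap is NOT proved by any of this.**  No `sorry`, no `instance`, no `notation`, no `def`; standard axioms.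
-/

noncomputable section

open scoped BigOperators
open Finset

namespace Summit.QuantumFields.YangMills.Theorems.BalabanUVNodesPortS1

open Summit.QuantumFields.YangMills.Theorems.K0RecordFormatNames
open Literature.MathematicalPhysics.QuantumFieldTheory.Balaban1983to89
open Literature.MathematicalPhysics.QuantumFieldTheory.Balaban1983to89.Node00
open Literature.MathematicalPhysics.QuantumFieldTheory.Balaban1983to89.T4Continuum (T4Family)
open Literature.MathematicalPhysics.QuantumFieldTheory.Balaban1983to89.TreeLengthTorus (TPt natLift proj proj_natLift)
open Literature.MathematicalPhysics.QuantumFieldTheory.Balaban1983to89.TreeLengthTorusTransfer (tblock)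
open Literature.MathematicalPhysics.QuantumFieldTheory.Balaban1983to89.B13ScaleTransfer (Pt block mem_block)
open Literature.MathematicalPhysics.QuantumFieldTheory.Balaban1983to89.B3Taylor310LocalRemainder (tdist_eq_sum_natAbs)

namespace G3CGeom

/-! ## §1  ZMod: cube classes two apart force residues one cube apart -/

/-- **Cube classes `≥ 2` apart ⟹ residues `≥ M` apart** (mod `q·M`): the converse companion of ✓`PortHRecordRowG.dist_le_mul_idx_add`. [folklore] -/
theorem le_natAbs_valMinAbs_of_two_le {N q M : ℕ} [NeZero N] [NeZero q] (hM : 0 < M) (hN : N = q * M) (u w : ZMod N)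
    (h2 : 2 ≤ ((((u.val / M : ℕ)) : ZMod q) - (((w.val / M : ℕ)) : ZMod q)).valMinAbs.natAbs) :
    M ≤ (u - w).valMinAbs.natAbs := by
  by_contra hlt
  push Not at hlt
  set a := u.val / M with ha
  set r := u.val % M with hr
  set a' := w.val / M with ha'
  set r' := w.val % M with hr'
  have hrlt : r < M := Nat.mod_lt _ hM
  have hrlt' : r' < M := Nat.mod_lt _ hM
  have hu : u = ((M * a + r : ℕ) : ZMod N) := by
    rw [show M * a + r = u.val from Nat.div_add_mod u.val M]; exact (ZMod.natCast_zmod_val u).symm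
  have hw : w = ((M * a' + r' : ℕ) : ZMod N) := by
    rw [show M * a' + r' = w.val from Nat.div_add_mod w.val M]; exact (ZMod.natCast_zmod_val w).symm
  have hdiff : u - w = (((M : ℤ) * ((a : ℤ) - (a' : ℤ)) + ((r : ℤ) - (r' : ℤ)) : ℤ) : ZMod N) := by
    rw [hu, hw]; push_cast; ring
  set v : ℤ := (u - w).valMinAbs with hv
  have hvcast : ((v : ℤ) : ZMod N) = (((M : ℤ) * ((a : ℤ) - (a' : ℤ)) + ((r : ℤ) - (r' : ℤ)) : ℤ) : ZMod N) := by
    rw [hv, ZMod.coe_valMinAbs, hdiff]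
  obtain ⟨t, ht⟩ := (ZMod.intCast_eq_intCast_iff_dvd_sub _ _ _).1 hvcast.symm
  -- ht : v - (M(a−a') + (r−r')) = N * t, so v = M((a−a') + q t) + (r − r')
  have hvt : v = (M : ℤ) * (((a : ℤ) - (a' : ℤ)) + (q : ℤ) * t) + ((r : ℤ) - (r' : ℤ)) := by
    have hN' : (N : ℤ) = (q : ℤ) * (M : ℤ) := by rw [hN]; push_cast; ring
    rw [hN'] at ht
    linear_combination ht
  have hvabs : v.natAbs < M := hlt
  -- |M((a−a') + qt)| ≤ |v| + |r − r'| < 2M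
  have hsmall : (((a : ℤ) - (a' : ℤ)) + (q : ℤ) * t).natAbs ≤ 1 := by
    have h1 : ((M : ℤ) * (((a : ℤ) - (a' : ℤ)) + (q : ℤ) * t)).natAbs ≤ v.natAbs + ((r : ℤ) - (r' : ℤ)).natAbs := by
      have e : (M : ℤ) * (((a : ℤ) - (a' : ℤ)) + (q : ℤ) * t) = v - ((r : ℤ) - (r' : ℤ)) := by rw [hvt]; ring
      rw [e]; exact Int.natAbs_sub_le _ _
    rw [Int.natAbs_mul, Int.natAbs_natCast] at h1
    have h2 : ((r : ℤ) - (r' : ℤ)).natAbs ≤ M - 1 := by omega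
    have h3 : M * (((a : ℤ) - (a' : ℤ)) + (q : ℤ) * t).natAbs < M * 2 := by omega
    have := Nat.lt_of_mul_lt_mul_left h3
    omega
  -- the class of a − a' mod q is that of (a−a') + qt, whose least absolute residue is ≤ 1
  have hcls : (((u.val / M : ℕ) : ZMod q) - (((w.val / M : ℕ)) : ZMod q)) = (((((a : ℤ) - (a' : ℤ)) + (q : ℤ) * t : ℤ)) : ZMod q) := by
    rw [← ha, ← ha']
    push_cast
    rw [ZMod.natCast_self, zero_mul, add_zero]
  rw [hcls] at h2
  have h4 := PortHRecordRowG.natAbs_valMinAbs_intCast_le (N := q) (((a : ℤ) - (a' : ℤ)) + (q : ℤ) * t)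
  omega

/-! ## §2  Off the `3^d` block: some coordinate classes are two apart -/

/-- **`c ∉ tblock q` ⟹ some coordinate classes of `c` and `q` differ by `≥ 2`** (circularly): otherwise `natLift q` shifted by the least absolute residues of `c − q` is a point of
`block (natLift q)` projecting to `c`. [cite: Balaban1987RG1, p.257 (□̃)] -/
theorem exists_two_le_of_not_mem_tblock {d N : ℕ} [NeZero N] {c q : TPt d N} (h : c ∉ tblock q) :
    ∃ μ : Fin d, 2 ≤ (c μ - q μ).valMinAbs.natAbs := by
  by_contra hcon
  push Not at hcon
  apply h
  refine Finset.mem_image.2 ⟨fun μ => natLift q μ + (c μ - q μ).valMinAbs, ?_, ?_⟩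
  · rw [mem_block]
    intro μ
    have h1 := hcon μ
    have h2 : -1 ≤ (c μ - q μ).valMinAbs ∧ (c μ - q μ).valMinAbs ≤ 1 := by
      constructor <;> omega
    exact ⟨by omega, by omega⟩
  · funext μ
    simp only [proj, Int.cast_add, ZMod.coe_valMinAbs]
    have : ((natLift q μ : ℤ) : ZMod N) = q μ := by simp [natLift]
    rw [this]; ring

/-! ## §3  At the record: one full cube of lattice distance -/

variable {F : T4Family}

/-- Tiling at level `k`: `N_k = domCount · (L·Mc)` (from ✓`sitesPerDir_eq_domCount_mul` at level `k+1` and `N_k = L·N_{k+1}`). [cite: Balaban1987RG1, p.257 (the cubes π_j)] -/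
theorem sitesPerDir_k_eq_domCount_mul {Mc k K : ℕ} (hMc : McGuard F Mc) (hK : recordK₀ F Mc k ≤ K) :
    (F.P K).sitesPerDir k = Sect2.domCount (F.P K) Mc (k + 1) * (F.L * Mc) := by
  have hk := succ_le_m_add_K_of_recordK₀_le hK
  have h1 := PortHRecordRowG.sitesPerDir_eq_domCount_mul hMc hK
  have h2 : (F.P K).sitesPerDir k = F.L * (F.P K).sitesPerDir (k + 1) := by
    rw [TreeLengthTorus.sitesPerDir_eq_pow_mul (F.P K) (Nat.le_succ k) hk]
    have e : k + 1 - k = 1 := by omega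
    rw [e, pow_one, F.P_L]
  rw [h2, h1]; ring

/-- The cube label of a level-`k` site through its block: `(cubeOfSite (blockOf x))_μ = ⌊x_μ ∕ (L·Mc)⌋` as a residue. [cite: Balaban1987RG1, p.257 (bookkeeping)] -/
theorem cubeOfSite_blockOf_apply {Mc k K : ℕ} (hK : recordK₀ F Mc k ≤ K) (x : Site (F.P K) k) (μ : Fin (F.P K).d) :
    cubeOfSite F Mc k K (blockOf x) μ = ((((x μ).val / (F.L * Mc) : ℕ)) : ZMod (Sect2.domCount (F.P K) Mc (k + 1))) := by
  have hk := succ_le_m_add_K_of_recordK₀_le hK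
  show ((((blockOf x) μ).val / Mc : ℕ) : ZMod (Sect2.domCount (F.P K) Mc (k + 1))) = _
  rw [Site.val_blockOf hk, Nat.div_div_eq_div_mul, F.P_L]

/-- ★ **TWO CUBES OFF EACH OTHER'S BLOCK ARE ONE FULL CUBE APART**: if the cube of `x` is not in `tblock` of the cube of `y` (level-`k` sites, cubes of `𝐃_{k+1}`), then `L·Mc ≤ tdist x y`.
[cite: Balaban1987RG1, p.257 (□̃, d_j); Balaban1985BackgroundPropagators, (3.94) p.410] -/
theorem mul_le_tdist_of_cube_not_mem_tblock {Mc k K : ℕ} (hMc : McGuard F Mc) (hK : recordK₀ F Mc k ≤ K) (x y : Site (F.P K) k)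
    (h : cubeOfSite F Mc k K (blockOf x) ∉ tblock (cubeOfSite F Mc k K (blockOf y))) :
    F.L * Mc ≤ Site.tdist x y := by
  obtain ⟨μ, hμ⟩ := exists_two_le_of_not_mem_tblock h
  rw [cubeOfSite_blockOf_apply hK, cubeOfSite_blockOf_apply hK] at hμ
  have hLM : 0 < F.L * Mc := Nat.mul_pos (by have := F.hL.2; omega) (PortHRecordRowG.mc_pos hMc)
  have hcoord := le_natAbs_valMinAbs_of_two_le hLM (sitesPerDir_k_eq_domCount_mul hMc hK) (x μ) (y μ) hμ
  rw [tdist_eq_sum_natAbs]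
  exact hcoord.trans (Finset.single_le_sum (f := fun ν => (x ν - y ν).valMinAbs.natAbs) (fun ν _ => Nat.zero_le _) (Finset.mem_univ μ))

end G3CGeom

end Summit.QuantumFields.YangMills.Theorems.BalabanUVNodesPortS1

end
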